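import Summits.BirchSwinnertonDyer.BirchSwinnertonDyer.Theorems.SignedLowerHalvesRibetBadEulerFactorOfNewness
import Literature.NumberTheory.EllipticCurves.CMNewformGamma0PrimitiveIsNewformHolds
import HarnessLib

/-!
# Route `SignedLowerHalves`, crux L `SmallImageLowerHalfBothSigns` (stmt-BirchSwinnertonDyer-23599), line `rtt_w3`: the Ribet (BAD) Euler-factor
# fact `Ribet1977_cmNewform_gamma0_badEulerFactor_padicCharacter` HOLDS unconditionally (INPUTS seat `bsd-inputs-honda-p1` g35; THEOREMS ONLY)

WHAT.  File 3 of the g33 de-cite (`SignedLowerHalvesRibetBadEulerFactorOfNewness.lean`) derived the residual cite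
`Ribet1977_cmNewform_gamma0_badEulerFactor_padicCharacter` (the Euler factors of the `Γ₀` CM newform at the primes `ℓ ∣ |d_K|·N𝔪` through the
`p`-adic avatar) FROM Shimura's newness fact `shimura1972_heckeTheta_isNewform0_of_primitive`; g34 reduced Shimura's fact to Hecke's functional
equation with conductor (`…_of_heckeFE`); g35 PROVED that functional equation (`Hecke_functionalEquation_infinityType_conductor_holds`, Hecke's theta
integral with harmonic weight — `Literature/NumberTheory/LFunctions/ImaginaryQuadraticGrossencharakterFunctionalEquation.lean`) and hence Shimura's fact
(`shimura1972_heckeTheta_isNewform0_of_primitive_holds`).  This file records the unconditional consequences for the line: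

* ★★ `ribet1977_cmNewform_gamma0_badEulerFactor_padicCharacter_holds : Ribet1977_cmNewform_gamma0_badEulerFactor_padicCharacter`.

RECIPE for the LEAD (v49 of `Lines/rtt_w3.lean`): DROP the last conjunct `Hecke_functionalEquation_infinityType_conductor` of `stub_citedInputs_rtt`
(22 → 21 conjuncts), import this file, and in `SmallImageLowerHalfBothSigns_of` replace the two `have hSh / hRes` lines by
`have hRes := Summit.BirchSwinnertonDyer.BirchSwinnertonDyer.Theorems.RibetBadEulerFactor.ribet1977_cmNewform_gamma0_badEulerFactor_padicCharacter_holds`.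

HONEST SCOPE: removes ONE cited print fact from crux L's input list (the Hecke/de Shalit functional equation is now a tree theorem); crux L remains a
kernel theorem only modulo its other 21 cited print facts and crux M (`stub_muOneSign_ns_ge5`, conjecture-grade); BSD is proved for NO curve.

References: [Ribet1977Nebentypus] §3 Cor. (3.5), Remark (3.5); [Shimura1972ClassFieldsRealQuadratic] p. 138; [Miyake2006] Thm. 4.8.2;
[deShalit1987] II §1.1 (1)–(3); [NeukirchANT1999] Ch. VII §8 (8.5)–(8.6); [HeckeMathZ1920].
-/

set_option autoImplicit false

noncomputable section

open Literature.NumberTheory.EllipticCurves Literature.NumberTheory.EllipticCurves.ModularForms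

namespace Summit.BirchSwinnertonDyer.BirchSwinnertonDyer.Theorems.RibetBadEulerFactor

/-- ★★ **Ribet's bad Euler factors through the `p`-adic character HOLD** (Ribet 1977 §3 Cor. (3.5) with Remark (3.5)): the named fact
`Ribet1977_cmNewform_gamma0_badEulerFactor_padicCharacter`, unconditionally — `…_of_shimura` (g33) fed with the PROVED Shimura newness (g35, from the
proved Hecke functional equation with conductor). [cite: Ribet1977Nebentypus, §3 Cor. (3.5) and Remark (3.5) (LNM 601, p. 35)] [cite: Miyake2006, Thm. 4.8.2]
[cite: NeukirchANT1999, Ch. VII §8 Thm. (8.5), Cor. (8.6)] -/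
theorem ribet1977_cmNewform_gamma0_badEulerFactor_padicCharacter_holds : Ribet1977_cmNewform_gamma0_badEulerFactor_padicCharacter :=
  ribet1977_cmNewform_gamma0_badEulerFactor_padicCharacter_of_shimura shimura1972_heckeTheta_isNewform0_of_primitive_holds

end Summit.BirchSwinnertonDyer.BirchSwinnertonDyer.Theorems.RibetBadEulerFactor

end
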